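import Summits.ValiantsHypothesis.ValiantsHypothesis.Theorems.KPlusLogSqLawStaticPathTrain
import Summits.ValiantsHypothesis.ValiantsHypothesis.Theorems.KPlusLogSqLawPiecewiseAffine

/-!
# Route «KPlusLogSqLaw» — the ALTERNATING FOLD LEMMA, part 4: the fold and the train are piecewise affine off the endpoint set

HONEST FRAMING.  Helper toward the crux `WeakLifting` (item `stmt-ValiantsHypothesis-19561`, route `KPlusLogSqLaw`, cell
`pub-symmetroid`, seat val-sym-lift-p3 g6, 2026-08-27) on the line of its witness-plan stub `stub_tridiagonalSectorB` (tropical twin of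
the STATIC tridiagonal sector = parametric max-weight independent set on a path; val-sym-lift-p4 g6 `HOME/val-sym-lift-p4/STATIC-PATH-NLOGN.md`).
The set-form of the degeneracy-free fold lemma: for `n + 1` pairwise-distinct lines, the ACTIVE INDEX of the alternating fold is CONSTANT
on every open interval missing the endpoint set `B n` (`lab_eq_of_free`; `|B n| ≤ 4 (n + 1)`, part 1), hence the fold is affine on every
closed interval with `B n`-free interior (`pa_fold`: the kink-set certificate `PA (fold n) (B n)` of `KPlusLogSqLawPiecewiseAffineDefs.lean`),
and so is the LEFT TRAIN `Δ n` of an `n`-item path block (`pa_train`, via part 3's `fold_alt_eq`): in the words of STATIC-PATH-NLOGN §4,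
«pieces(Δ_n) ≤ 4n + 5» WITHOUT general position.  This is the input the divide-and-conquer of §5–6 consumes (junction law `pa_max` of
`KPlusLogSqLawPiecewiseAffine.lean`).  Statements about lines; nothing here asserts anything about `WeakLifting`, `TropicalB`, `KPlusLogSqLaw`,
the stub in its window, `MatrixDescartes` (stmt-ValiantsHypothesis-18050) or `VP ≠ VNP`.
-/

set_option linter.dupNamespace false
set_option autoImplicit false

namespace Summit.ValiantsHypothesis.ValiantsHypothesis.Theorems.KPlusLogSqLaw

open Set Classical PiecewiseAffine

namespace StaticPathFold

noncomputable section

/-- **the active index is constant on open intervals missing the endpoint set.** [folklore] -/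
theorem lab_eq_of_free (a b : ℕ → ℝ) (n : ℕ) (hd : ∀ i j, i < j → j ≤ n → (a i ≠ a j ∨ b i ≠ b j)) {x y : ℝ}
    (hf : Free (B a b n) x y) {θ₁ θ₂ : ℝ} (h₁ : θ₁ ∈ Ioo x y) (h₂ : θ₂ ∈ Ioo x y) :
    lab a b n θ₁ = lab a b n θ₂ := by
  -- a change of the active index between two points produces a run supremum in between, which lies in `B n`
  have key : ∀ u v : ℝ, u ∈ Ioo x y → v ∈ Ioo x y → u < v → lab a b n u = lab a b n v := by
    intro u v hu hv huv
    by_contra hne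
    obtain ⟨hmem, hr1, hr2⟩ := sSup_run_mem a b n hd huv rfl (Ne.symm hne)
    rcases hf _ hmem with h | h
    · exact absurd (lt_of_lt_of_le hu.1 hr1) (not_lt.mpr h)
    · exact absurd (lt_of_le_of_lt hr2 hv.2) (not_lt.mpr h)
  rcases lt_trichotomy θ₁ θ₂ with h | h | h
  · exact key θ₁ θ₂ h₁ h₂ h
  · rw [h]
  · exact (key θ₂ θ₁ h₂ h₁ h).symm

/-- **the fold is piecewise affine off the endpoint set**: `PA (fold n) (B n)`. [folklore] -/
theorem pa_fold (a b : ℕ → ℝ) (n : ℕ) (hd : ∀ i j, i < j → j ≤ n → (a i ≠ a j ∨ b i ≠ b j)) :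
    PA (fold a b n) (B a b n) := by
  intro x y hxy hf
  rcases eq_or_lt_of_le hxy with heq | hlt
  · -- a single point: the fold is the active line there
    refine ⟨a (lab a b n x), b (lab a b n x), fun τ hτ => ?_⟩
    have hτx : τ = x := le_antisymm (heq ▸ hτ.2) hτ.1
    rw [hτx, fold_eq_lab]; rfl
  · -- the active index `j` of the midpoint serves on the whole open interval, and at the endpoints by continuity
    set j := lab a b n ((x + y) / 2) with hj
    have hmid : (x + y) / 2 ∈ Ioo x y := ⟨by linarith, by linarith⟩
    have hopen : ∀ τ ∈ Ioo x y, fold a b n τ = L a b j τ := by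
      intro τ hτ
      rw [fold_eq_lab, lab_eq_of_free a b n hd hf hτ hmid]
    have hclosed : IsClosed {τ : ℝ | fold a b n τ = L a b j τ} := isClosed_eq (continuous_fold a b n) (continuous_L a b j)
    have hsub : Icc x y ⊆ {τ : ℝ | fold a b n τ = L a b j τ} := by
      rw [← closure_Ioo (ne_of_lt hlt)]
      exact closure_minimal (fun τ hτ => hopen τ hτ) hclosed
    exact ⟨a j, b j, fun τ hτ => hsub hτ⟩

/-- **the left train of an `n`-item path block is piecewise affine off the endpoint set of its prefix-sum lines** (at most `4 (n + 1)`
points; STATIC-PATH-NLOGN Theorem P2 in certificate form, no general position). [folklore] -/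
theorem pa_train (w₁ w₀ : ℕ → ℝ) (n : ℕ)
    (hd : ∀ i j, i < j → j ≤ n → (altA w₁ i ≠ altA w₁ j ∨ altB w₀ i ≠ altB w₀ j)) :
    PA (Δ w₁ w₀ n) (B (altA w₁) (altB w₀) n) := by
  have h1 := pa_fold (altA w₁) (altB w₀) n hd
  have h2 : PA (L (altA w₁) (altB w₀) n) ∅ := pa_affine _ _
  by_cases he : Even n
  · -- `Δ n = S n - fold n`
    have h3 := (h2.sub h1)
    rw [Finset.empty_union] at h3
    refine h3.congr fun τ => ?_
    have h4 := fold_alt_eq w₁ w₀ n τ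
    rw [if_pos he] at h4
    show Δ w₁ w₀ n τ = L (altA w₁) (altB w₀) n τ - fold (altA w₁) (altB w₀) n τ
    linarith
  · -- `Δ n = fold n - S n`
    have h3 := (h1.sub h2)
    rw [Finset.union_empty] at h3
    refine h3.congr fun τ => ?_
    have h4 := fold_alt_eq w₁ w₀ n τ
    rw [if_neg he] at h4
    show Δ w₁ w₀ n τ = fold (altA w₁) (altB w₀) n τ - L (altA w₁) (altB w₀) n τ
    linarith

/-- the certificate of `pa_train` has at most `4 (n + 1)` points. [folklore] -/
theorem card_train_cert_le (w₁ w₀ : ℕ → ℝ) (n : ℕ) : (B (altA w₁) (altB w₀) n).card ≤ 4 * (n + 1) :=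
  card_B_le _ _ n

end

end StaticPathFold

end Summit.ValiantsHypothesis.ValiantsHypothesis.Theorems.KPlusLogSqLaw
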